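import Summits.MatrixMultiplication.OmegaCensus.STPP222Pow6RotationFamily

/-!
# ω-census, STPP pattern `(2,2,2)^8`: a UNIFORM family — `ℤ/n × ℤ/n` admits it for every `n ≥ 18`

HONEST FRAMING (pub-omega census; verbatim): lottery ticket; floor = certified bounds/negative ranges.
Census STRUCTURE bookkeeping (question Q7 of the pub-omega cell; CKSU 2005 Def. 5.1, tree form `IsSTPP`), not progress
on `ω`: a `(2,2,2)^k` family certifies no matrix-multiplication bound of interest, and every `n² ≥ 324` here lies above
the kernel threshold `N₈ ≤ 196` (→ `194` pending), so no onset value moves.  The point is a UNIFORM CONSTRUCTION for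
`k = 8`, companion of `exists_isSTPP_222pow6_zmod_sq` (`STPP222Pow6RotationFamily.lean`): ONE integer configuration in
`ℤ × ℤ` whose reductions give eight simultaneous-TPP triples of 2-subsets of `ℤ/n × ℤ/n` for all `n ≥ 18`.  The smallest
group of this shape with a kernel `(2,2,2)⁸` witness stays ℤ/13 × ℤ/13 (`exists_isSTPP_222pow8_pp_13_13`, an orbit family
of a different, order-8 subgroup of `GL₂(𝔽₁₃)`); explicit (non-uniform) rotation families also exist for `n = 13, …, 17`
(seat desk searches, not filed).

THE CONFIGURATION (seat pub-omega-stpp-3 gen 17, 2026-08-26; found by the box-restricted complete 'mixed-orbit' search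
`orbmix.c` pattern `GG` — ℤ² emulated in `ℤ/67 × ℤ/67` with all entries of sup-norm `≤ 4`, so no word wraps).  Let
`r = [[0,−1],[1,0]] ∈ GL₂(ℤ)` (the rotation by a quarter turn, order 4, `r(x,y) = (−y, x)`), `K = ⟨r⟩ ≅ C₄`.  Two GENERIC base
triples `T₀ = ({(0,0),(0,1)}, {(0,2),(0,4)}, {(0,−4),(1,−4)})`, `T₁ = ({(0,0),(0,2)}, {(2,−4),(3,−4)}, {(−3,3),(−3,4)})`; the family
is `(rⁱA_j, rⁱB_j, rⁱC_j)` for `i = 0,…,3`, `j = 0,1` — written out as `rot8A`, `rot8B`, `rot8C` below.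

PROOF (same machinery as the `k = 6` file, whose generic lemmas are reused): over `ℤ × ℤ` the configuration passes
`stppCheck` (kernel, 32 768 words) and every constraint expression has both coordinates of absolute value `≤ 19`
(`Rot6.stppExprBound2`, kernel; `19` is attained) ⇒ transfer (`Rot6.stppCheck_map_cast_zmod2`) to every `n ≥ 20`; for
`n = 18, 19` the same configuration reduced mod `n` passes `stppCheck` by kernel evaluation; all pairs differ in some
coordinate by `1` or `2` (`Rot6.pairGapCheck2 … 2`).  Desk cross-check (Python, literal Def. 5.1): PASS for every
`18 ≤ n ≤ 80`, FAIL for `9 ≤ n ≤ 17` (this configuration; other rotation families exist there).  No minimality claim.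

References: H. Cohn, R. Kleinberg, B. Szegedy, C. Umans, FOCS 2005 (arXiv:math/0511460), Def. 5.1.
Seat pub-omega-stpp-3 (gen 17), 2026-08-26.
-/

open Literature.Computability.AlgebraicComplexity Finset

namespace Summit.MatrixMultiplication.OmegaCensus

namespace Rot8

open Rot6

/-- The integer configuration, `A`-pairs: `rⁱ{(0,0),(0,1)}` (`i = 0..3`) then `rⁱ{(0,0),(0,2)}`. -/
def rot8A : Fin 8 → List (ℤ × ℤ) :=
  ![[(0, 0), (0, 1)], [(0, 0), (-1, 0)], [(0, 0), (0, -1)], [(0, 0), (1, 0)],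
    [(0, 0), (0, 2)], [(0, 0), (-2, 0)], [(0, 0), (0, -2)], [(0, 0), (2, 0)]]

/-- The integer configuration, `B`-pairs: `rⁱ{(0,2),(0,4)}` then `rⁱ{(2,−4),(3,−4)}`. -/
def rot8B : Fin 8 → List (ℤ × ℤ) :=
  ![[(0, 2), (0, 4)], [(-2, 0), (-4, 0)], [(0, -2), (0, -4)], [(2, 0), (4, 0)],
    [(2, -4), (3, -4)], [(4, 2), (4, 3)], [(-2, 4), (-3, 4)], [(-4, -2), (-4, -3)]]

/-- The integer configuration, `C`-pairs: `rⁱ{(0,−4),(1,−4)}` then `rⁱ{(−3,3),(−3,4)}`. -/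
def rot8C : Fin 8 → List (ℤ × ℤ) :=
  ![[(0, -4), (1, -4)], [(4, 0), (4, 1)], [(0, 4), (-1, 4)], [(-4, 0), (-4, -1)],
    [(-3, 3), (-3, 4)], [(-3, -3), (-4, -3)], [(3, -3), (3, -4)], [(3, 3), (4, 3)]]

/-- The integer configuration satisfies CKSU Def. 5.1 in `ℤ × ℤ` (kernel evaluation of `stppCheck`, 32 768 words).
[cite: CohnKleinbergSzegedyUmans2005, Def. 5.1] -/
theorem stppCheck_rot8_int : stppCheck rot8A rot8B rot8C = true := by
  decide +kernel

/-- Every constraint expression of the integer configuration has both coordinates of absolute value `≤ 19` (kernel). -/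
theorem stppExprBound2_rot8 : stppExprBound2 rot8A rot8B rot8C 19 = true := by
  decide +kernel

/-- The 24 pairs of the configuration differ, in some coordinate, by a non-zero integer of absolute value `≤ 2` (kernel). -/
theorem pairGapCheck2_rot8 :
    pairGapCheck2 rot8A 2 = true ∧ pairGapCheck2 rot8B 2 = true ∧ pairGapCheck2 rot8C 2 = true := by
  refine ⟨?_, ?_, ?_⟩ <;> decide +kernel

/-- For every modulus `n ≥ 20` the integer configuration reduced by `castZ2 n` passes `stppCheck` in `ℤ/n × ℤ/n`. -/
theorem stppCheck_rot8_zmod {n : ℕ} (hn : 20 ≤ n) :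
    stppCheck (fun i => (rot8A i).map (castZ2 n)) (fun i => (rot8B i).map (castZ2 n))
      (fun i => (rot8C i).map (castZ2 n)) = true :=
  stppCheck_map_cast_zmod2 stppCheck_rot8_int stppExprBound2_rot8 (by omega)

/-- For the two small moduli `n = 18, 19` the SAME configuration reduced mod `n` passes `stppCheck` in `ℤ/n × ℤ/n`
(kernel evaluation). [cite: CohnKleinbergSzegedyUmans2005, Def. 5.1] -/
theorem stppCheck_rot8_small : ∀ n ∈ Finset.Icc 18 19,
    stppCheck (fun i => (rot8A i).map (castZ2 n)) (fun i => (rot8B i).map (castZ2 n))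
      (fun i => (rot8C i).map (castZ2 n)) = true := by
  decide +kernel

end Rot8

open Rot6 Rot8 in
/-- **The quarter-turn family: `ℤ/n × ℤ/n` admits the STPP pattern `(2,2,2)⁸` for every `n ≥ 18`.**  There are eight
triples `(Aᵢ, Bᵢ, Cᵢ)` of 2-element subsets of `ZMod n × ZMod n` satisfying the simultaneous triple product property (CKSU
2005 Def. 5.1, tree form `IsSTPP`): the reductions mod `n` of the integer configuration `rot8A/B/C` = the `C₄ = ⟨r⟩` orbits
(`r` = quarter-turn rotation of `ℤ²`) of the two generic triples `({(0,0),(0,1)}, {(0,2),(0,4)}, {(0,−4),(1,−4)})` and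
`({(0,0),(0,2)}, {(2,−4),(3,−4)}, {(−3,3),(−3,4)})`.  Proof: transfer lemma for `n ≥ 20` (expression bound `19`), kernel
evaluation for `n = 18, 19`, pair gaps `≤ 2`.  Census STRUCTURE entry; no threshold moves and no `ω` bound follows.
[cite: CohnKleinbergSzegedyUmans2005, Def. 5.1] -/
theorem exists_isSTPP_222pow8_zmod_sq (n : ℕ) (hn : 18 ≤ n) :
    ∃ A B C : Fin 8 → Finset (ZMod n × ZMod n),
      IsSTPP A B C ∧ ∀ i, (A i).card = 2 ∧ (B i).card = 2 ∧ (C i).card = 2 := by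
  have hc : ∀ i, (((rot8A i).map (castZ2 n)).toFinset).card = 2 ∧ (((rot8B i).map (castZ2 n)).toFinset).card = 2 ∧
      (((rot8C i).map (castZ2 n)).toFinset).card = 2 := fun i =>
    ⟨card_of_pairGapCheck2 pairGapCheck2_rot8.1 (by omega) i, card_of_pairGapCheck2 pairGapCheck2_rot8.2.1 (by omega) i,
      card_of_pairGapCheck2 pairGapCheck2_rot8.2.2 (by omega) i⟩
  by_cases h20 : 20 ≤ n
  · exact exists_isSTPP_222pow_of_lists _ _ _ (stppCheck_rot8_zmod h20) hc
  · have hmem : n ∈ Finset.Icc 18 19 := by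
      rw [Finset.mem_Icc]; omega
    exact exists_isSTPP_222pow_of_lists _ _ _ (stppCheck_rot8_small n hmem) hc

end Summit.MatrixMultiplication.OmegaCensus
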